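import Literature.AlgebraicGeometry.Frobenioids.ModelFrobenioidSelfEquivalenceRigidityGenerators
import HarnessLib

/-!
# Frobenioids I, Thm. 5.2 (iv) / Prop. 5.6: twisted unit cocycles on a model Frobenioid — part 3
# (every twisted unit cocycle is the twisted coboundary of the Prop. 5.6 units)

Mochizuki, *The geometry of Frobenioids I: the general theory*, Kyushu J. Math. **62** (2008)
293–400, §5, Theorem 5.2 (i) p. 100 (the factorisation of a morphism of the model Frobenioid through its
Frobenius, base-identity and pull-back parts is read off the quadruple `(deg_Fr, Base, Div, u)`),
Theorem 5.2 (iv) pp. 101–103 ("for the final entry, it follows from the existence of the unique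
factorizations of morphisms of `E`"), Proposition 5.6 p. 105 [cite: MochizukiFrdI2008, Thm. 5.2 p.100];
[IUTchI] p. 145 l. 7–9 ("the various units obtained in [FrdI], Proposition 5.6, determine […] an
isomorphism between `α` and the identity self-equivalence").

PROOF-ONLY (abc-iut, row «S2′», this file abc-iut-L1-t7; sequel of `…Cocycle.lean` / `…Generators.lean`).
For a twisted unit cocycle `κ` with (K1), (K2) on `C = ModelFrobenioid Φ B DivB` (`B` objectwise group-like):
the coboundary identity `κ(φ) · Base(φ)^* ω_Y = u_φ · ω_X^{deg_Fr φ}` is stable under composition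
(`coboundary_comp`), and since every morphism factors as `(d, b, z, u) = (1, b, 0, 1) ∘ (1, id, z, u) ∘
(d, id, 0, 1)` the three generator cases give it for ALL morphisms: `exists_coboundary` — **every twisted
unit cocycle satisfying (K1), (K2) is the twisted coboundary, relative to `u`, of a family of units
`ω_X ∈ B(Base X)`**.  No statement of either paper is restated as a fact; nothing here bears on
[IUTchIII] Cor. 3.12.
-/

namespace Literature.AlgebraicGeometry.Frobenioids

open CategoryTheory Opposite

universe w v u

namespace ModelFrobenioid

variable {D : Type u} [Category.{v} D] {Φ B : Dᵒᵖ ⥤ CommMonCat.{w}} {DivB : B ⟶ monoidGp Φ}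
  (hB : ∀ (A : Dᵒᵖ) (b : B.obj A), IsUnit b)
  (κ : ∀ ⦃X Y : ModelFrobenioid Φ B DivB⦄, (X ⟶ Y) → B.obj (op X.base))
  (hκc : ∀ ⦃X Y Z : ModelFrobenioid Φ B DivB⦄ (φ : X ⟶ Y) (ψ : Y ⟶ Z),
    κ (φ ≫ ψ) = pull B (baseMap φ) (κ ψ) * κ φ ^ (degFr ψ : ℕ))
  (hκr : ∀ ⦃X Y : ModelFrobenioid Φ B DivB⦄ (f g : X ⟶ Y), degFr f = 1 → degFr g = 1 →
    baseMap f = baseMap g → κ f * unit g = κ g * unit f)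

include hκc in
/-- **The coboundary identity is stable under composition**: if `κ(φ) · Base(φ)^* ω_Y = u_φ · ω_X^{deg φ}` and
`κ(ψ) · Base(ψ)^* ω_Z = u_ψ · ω_Y^{deg ψ}`, then the same holds for `ψ ∘ φ` — by (K1) and the composition law
`u_{ψ∘φ} = Base(φ)^* u_ψ + deg_Fr(ψ) · u_φ` of Thm. 5.2 (i). [cite: MochizukiFrdI2008, Thm. 5.2(i) p.100] -/
theorem coboundary_comp (ω : ∀ X : ModelFrobenioid Φ B DivB, B.obj (op X.base))
    {X Y Z : ModelFrobenioid Φ B DivB} (φ : X ⟶ Y) (ψ : Y ⟶ Z)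
    (hφ : κ φ * pull B (baseMap φ) (ω Y) = unit φ * ω X ^ (degFr φ : ℕ))
    (hψ : κ ψ * pull B (baseMap ψ) (ω Z) = unit ψ * ω Y ^ (degFr ψ : ℕ)) :
    κ (φ ≫ ψ) * pull B (baseMap (φ ≫ ψ)) (ω Z) = unit (φ ≫ ψ) * ω X ^ (degFr (φ ≫ ψ) : ℕ) := by
  rw [hκc φ ψ, baseMap_comp, pull_comp, unit_comp_pull, degFr_comp, PNat.mul_coe]
  calc pull B (baseMap φ) (κ ψ) * κ φ ^ (degFr ψ : ℕ) * pull B (baseMap φ) (pull B (baseMap ψ) (ω Z))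
        = pull B (baseMap φ) (κ ψ * pull B (baseMap ψ) (ω Z)) * κ φ ^ (degFr ψ : ℕ) := by
          rw [map_mul]; ac_rfl
    _ = pull B (baseMap φ) (unit ψ) * (κ φ * pull B (baseMap φ) (ω Y)) ^ (degFr ψ : ℕ) := by
          rw [hψ, map_mul, map_pow, mul_pow]; ac_rfl
    _ = pull B (baseMap φ) (unit ψ) * unit φ ^ (degFr ψ : ℕ) * ω X ^ ((degFr ψ : ℕ) * (degFr φ : ℕ)) := by
          rw [hφ, mul_pow, ← pow_mul, mul_comm (degFr φ : ℕ), mul_assoc]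

include hB hκc hκr in
/-- **Every twisted unit cocycle is a twisted coboundary** (the model-Frobenioid content of "the various
units obtained in [FrdI], Proposition 5.6, determine an isomorphism"): for `κ` with (K1), (K2) on the model
Frobenioid of `(Φ, B, Div_B)`, `B` objectwise group-like, there is a family of units `ω_X ∈ B(Base X)` with
`κ(φ) · Base(φ)^* ω_Y = u_φ · ω_X^{deg_Fr φ}` for EVERY morphism `φ : X → Y`.  Proof: the units of
`exists_omega`; the generator cases `kappa_frob`, `kappa_linear`, `kappa_pullback`; the factorisation
`φ = (1, Base φ, 0, 1) ∘ (1, id, Div φ, u_φ) ∘ (deg_Fr φ, id, 0, 1)`. [cite: MochizukiFrdI2008, Thm. 5.2(iv) p.102] -/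
theorem exists_coboundary :
    ∃ ω : ∀ X : ModelFrobenioid Φ B DivB, B.obj (op X.base), ∀ ⦃X Y : ModelFrobenioid Φ B DivB⦄ (φ : X ⟶ Y),
      κ φ * pull B (baseMap φ) (ω Y) = unit φ * ω X ^ (degFr φ : ℕ) := by
  choose ω hω using fun X => exists_omega hB κ hκc hκr X
  refine ⟨ω, fun X Y φ => ?_⟩
  -- the factorisation `φ = p ∘ ℓ ∘ Fr`
  let Xd : ModelFrobenioid Φ B DivB := ⟨X.base, X.cls ^ (degFr φ : ℕ)⟩
  let X'' : ModelFrobenioid Φ B DivB := ⟨X.base, pullGp Φ (baseMap φ) Y.cls⟩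
  let Fr : X ⟶ Xd := mkHom _ _ (degFr φ) (𝟙 X.base) 1 1 (rel_frob X.cls (degFr φ))
  let ℓ : Xd ⟶ X'' := mkHom _ _ 1 (𝟙 X.base) (div φ :) (unit φ :) (by
    rw [PNat.one_coe, pow_one, pullGp_id]
    exact rel φ)
  let p : X'' ⟶ Y := mkHom _ _ 1 (baseMap φ :) 1 1 (by
    simp only [PNat.one_coe, pow_one, map_one, mul_one]
    rfl)
  have hfac : φ = Fr ≫ ℓ ≫ p := by
    refine hom_ext ?_ ?_ ?_ ?_
    · show degFr φ = 1 * 1 * degFr φ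
      rw [one_mul, one_mul]
    · show baseMap φ = 𝟙 X.base ≫ 𝟙 X.base ≫ baseMap φ
      rw [Category.id_comp, Category.id_comp]
    · show div φ = pull Φ (𝟙 X.base) (pull Φ (𝟙 X.base) 1 * div φ ^ ((1 : ℕ+) : ℕ)) *
        (1 : Φ.obj (op X.base)) ^ ((1 * 1 : ℕ+) : ℕ)
      simp only [map_one, one_mul, mul_one, pull_id, PNat.one_coe, pow_one]
    · show unit φ = pull B (𝟙 X.base) (pull B (𝟙 X.base) 1 * unit φ ^ ((1 : ℕ+) : ℕ)) *
        (1 : B.obj (op X.base)) ^ ((1 * 1 : ℕ+) : ℕ)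
      simp only [map_one, one_mul, mul_one, pull_id, PNat.one_coe, pow_one]
  have hFr := kappa_frob hB κ hκc X (degFr φ) Fr rfl rfl rfl rfl (ω X) (ω Xd) (hω X) (hω Xd)
  have hℓ := kappa_linear hB κ hκc hκr Xd ℓ rfl rfl (ω Xd) (ω X'') (hω Xd) (hω X'')
  have hp := kappa_pullback hB κ hκc p rfl rfl rfl (ω X'') (ω Y) (hω X'') (hω Y)
  have h := coboundary_comp κ hκc ω Fr (ℓ ≫ p) hFr (coboundary_comp κ hκc ω ℓ p hℓ hp)
  rw [← hfac] at h
  exact h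

end ModelFrobenioid

end Literature.AlgebraicGeometry.Frobenioids
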